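import Summits.RiemannHypothesis.RiemannHypothesis.Theorems.S2FormatCGramYoshida
import Summits.RiemannHypothesis.RiemannHypothesis.Theorems.WeilFormatCFarAssembly
import HarnessLib

/-!
# Format C at `S = {∞, 2}` — L-C3a for the semilocal kernel: the sector kernels of `S2FormatC.gram b` are `⪰ diag(d̂^±)`
# on EVERY far truncation

Seat cc-s2-4 gen3 (`HOME/cc-s2-4/CC4-LEAN.md` §9.13).  weil-10's `WeilFormatCFarAssembly` proves the far diagonal bound
(hypothesis `hfar` of the rung theorems) for Yoshida's FULL Weil kernel `gramCoeff a` by adding the polar, prime and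
archimedean pieces.  The `{∞,2}` kernel `gram b = polarCoeff + Λ·(K_{log 2} − 2δ) + archCoeff` (`S2FormatC.gram_eq_yoshida`)
has the same polar and archimedean blocks and ONE prime length, so the same assembly gives, with the single-length path-graph
constant `A₂(b) = Λ·2cos(π/(⌊2b/log 2⌋ + 2))` (`= Λ` for `log 2 < 2b < 2 log 2`) in place of `A_op⁺(a)`:

* `gram_even_far_ge_diag` (`0 < b`, `log 2 < 2b`, `2 ≤ B`): `Σ_{n∈Ico B N} d̂⁺₂(n) y_n² ≤ Σ y_n M⁺_{gram b}(n,m) y_m`,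
  `d̂⁺₂(n) = ½(Re ψ(¼+iω_n/2) − log π) − b(1+E)/(π²n²) − 1/(8n) − (b(1+E)/π²)√(8/(B−1)) − A₂/2`;
* `gram_odd_far_ge_diag_atan` (`1 ≤ B`): `Σ_{k∈Ico B N} d̂⁻₂(k) z_k² ≤ Σ z_k M⁻_{gram b}(k,l) z_l`,
  `d̂⁻₂(k) = ½(Re ψ(¼+iω_{k+1}/2) − log π) − 1/(8(k+1)) − b(1+E)/(π²(k+1)²) − ½(π/2 − arctan(√B/√(k+1))) − (b(1+E)/π²)√(8/B)
  − A₂/2 − s²b/(π²B)`  (`E = weilArchDensity (2b)`, `s² = (e^{b/2} − e^{−b/2})²`).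

These are EXACTLY hypotheses `hfar_e` / `hfar_o` of `S2FormatC.le_threshold_of_formatC_certificates` (`S2FormatCCertificateTwo`)
with `de = d̂⁺₂`, `dodd = d̂⁻₂`; what an S = {2} rung still supplies per sector is `0 < d̂` on `m ≥ B`, the coupling majorant and
the kernel certificate.  Standard axioms; no definitions; no claim about RH.
-/

set_option linter.dupNamespace false
set_option autoImplicit false

noncomputable section

open Complex Set MeasureTheory Filter Finset
open scoped Real Topology ComplexConjugate BigOperators ArithmeticFunction.vonMangoldt

namespace Summit.RiemannHypothesis.RiemannHypothesis.Theorems.S2FormatC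

open Literature.NumberTheory.LFunctions Literature.Analysis.SpecialFunctions
open Literature.NumberTheory.LFunctions.Yoshida1992 (freq modes chi polarCoeff incrCoeff archCoeff)
open Summit.RiemannHypothesis.RiemannHypothesis.Theorems.WeilFormatC

section Far

variable {b : ℝ}

/-! ## The single-length prime block and its path-graph bound -/

/-- The prime block of the `{∞,2}` kernel is reflection-symmetric. -/
theorem primeTwo_neg_neg (b : ℝ) (n m : ℤ) :
    lam * (incrCoeff b (Real.log 2) (-n) (-m) - if -n = -m then 2 else 0) =
      lam * (incrCoeff b (Real.log 2) n m - if n = m then 2 else 0) := by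
  rw [incrCoeff_neg_neg]
  simp only [neg_inj]

/-- **PRIME₂ ⪰ −A₂·1 on every finite set of modes** (real vectors): for `0 < b`, `log 2 < 2b`, every finite `s ⊆ ℤ` and real `x`,
`−Λ·2cos(π/(⌊2b/log 2⌋+2))·Σ x_n² ≤ Σ_{n,m} x_n x_m · Λ(K_{log 2}(n,m) − 2δ)` (weil-10's `vonMangoldt_mul_incr_form_ge` at
`k = 2`, `Λ(2)/√2 = Λ`). -/
theorem primeTwo_form_ge_real (hb : 0 < b) (h2 : Real.log 2 < 2 * b) (s : Finset ℤ) (x : ℤ → ℝ) :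
    -(lam * (2 * Real.cos (π / (⌊2 * b / Real.log 2⌋₊ + 2))) * ∑ n ∈ s, x n ^ 2)
      ≤ ∑ n ∈ s, ∑ m ∈ s, x n * x m * (lam * (incrCoeff b (Real.log 2) n m - if n = m then 2 else 0)) := by
  have hk : 2 ∈ weilPrimeIndex b := by rw [mem_weilPrimeIndex]; push_cast; exact h2
  have h := vonMangoldt_mul_incr_form_ge hb s (fun n ↦ ((x n : ℝ) : ℂ)) hk
  have hΛ : (Λ 2 : ℝ) / Real.sqrt (2 : ℕ) = lam := by
    rw [ArithmeticFunction.vonMangoldt_apply_prime Nat.prime_two, lam]; push_cast; rfl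
  push_cast at h hΛ
  rw [hΛ] at h
  have e1 : ∑ n ∈ s, ‖((x n : ℝ) : ℂ)‖ ^ 2 = ∑ n ∈ s, x n ^ 2 :=
    Finset.sum_congr rfl fun n _ ↦ by rw [Complex.norm_real, Real.norm_eq_abs, sq_abs]
  have e2 : lam * ∑ n ∈ s, ∑ m ∈ s, (conj ((x n : ℝ) : ℂ) * ((x m : ℝ) : ℂ)).re *
        (incrCoeff b (Real.log 2) n m - if n = m then 2 else 0)
      = ∑ n ∈ s, ∑ m ∈ s, x n * x m * (lam * (incrCoeff b (Real.log 2) n m - if n = m then 2 else 0)) := by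
    rw [Finset.mul_sum]
    refine Finset.sum_congr rfl fun n _ ↦ ?_
    rw [Finset.mul_sum]
    refine Finset.sum_congr rfl fun m _ ↦ ?_
    rw [Complex.conj_ofReal, ← Complex.ofReal_mul, Complex.ofReal_re]
    ring
  rw [e1, e2] at h
  exact h

/-! ## The far diagonal bounds for `gram b` -/

/-- **L-C3a at `S = {2}`, even sector.**  For `0 < b`, `log 2 < 2b`, `2 ≤ B` and every `N`, `y`:
`Σ_{n∈Ico B N} d̂⁺₂(n) y_n² ≤ Σ_{n,m∈Ico B N} y_n M⁺_{gram b}(n,m) y_m` (module docstring for `d̂⁺₂`). -/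
theorem gram_even_far_ge_diag (hb : 0 < b) (h2 : Real.log 2 < 2 * b) {B : ℕ} (hB : 2 ≤ B) (N : ℕ) (y : ℕ → ℝ) :
    ∑ n ∈ Finset.Ico B N,
        ((reDigammaQuarter (freq b n) - Real.log π) / 2 - b * (1 + weilArchDensity (2 * b)) / (π ^ 2 * n ^ 2)
          - 1 / (8 * n) - b * (1 + weilArchDensity (2 * b)) / π ^ 2 * Real.sqrt (8 / ((B - 1 : ℕ) : ℝ))
          - lam * (2 * Real.cos (π / (⌊2 * b / Real.log 2⌋₊ + 2))) / 2)
          * y n ^ 2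
      ≤ ∑ n ∈ Finset.Ico B N, ∑ m ∈ Finset.Ico B N,
          y n * (if n = 0 then gram b 0 m else if m = 0 then gram b n 0
            else (gram b n m + gram b n (-(m : ℤ))) / 2) * y m := by
  have hB1 : 1 ≤ B := le_trans (by norm_num) hB
  have hs1 : ∀ n ∈ Finset.Ico B N, 1 ≤ n := fun n hn ↦ le_trans hB1 (Finset.mem_Ico.mp hn).1
  set Aop := lam * (2 * Real.cos (π / (⌊2 * b / Real.log 2⌋₊ + 2))) with hAop
  set P : ℤ → ℤ → ℝ := fun n m ↦ lam * (incrCoeff b (Real.log 2) n m - if n = m then 2 else 0) with hP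
  -- split the kernel
  have hsplit : ∀ n ∈ Finset.Ico B N, ∀ m ∈ Finset.Ico B N,
      y n * (if n = 0 then gram b 0 m else if m = 0 then gram b n 0
            else (gram b n m + gram b n (-(m : ℤ))) / 2) * y m
        = y n * (if n = 0 then polarCoeff b 0 m else if m = 0 then polarCoeff b n 0
            else (polarCoeff b n m + polarCoeff b n (-(m : ℤ))) / 2) * y m
          + y n * (if n = 0 then P 0 m else if m = 0 then P n 0 else (P n m + P n (-(m : ℤ))) / 2) * y m
          + y n * ((archCoeff b n m + archCoeff b n (-(m : ℤ))) / 2) * y m := by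
    intro n hn m hm
    rw [evenKernel_of_pos _ (hs1 n hn) (hs1 m hm), evenKernel_of_pos _ (hs1 n hn) (hs1 m hm),
      evenKernel_of_pos _ (hs1 n hn) (hs1 m hm), gram_eq_yoshida hb, gram_eq_yoshida hb]
    ring
  have hform : ∑ n ∈ Finset.Ico B N, ∑ m ∈ Finset.Ico B N,
      y n * (if n = 0 then gram b 0 m else if m = 0 then gram b n 0
            else (gram b n m + gram b n (-(m : ℤ))) / 2) * y m
      = (∑ n ∈ Finset.Ico B N, ∑ m ∈ Finset.Ico B N,
          y n * (if n = 0 then polarCoeff b 0 m else if m = 0 then polarCoeff b n 0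
            else (polarCoeff b n m + polarCoeff b n (-(m : ℤ))) / 2) * y m)
        + (∑ n ∈ Finset.Ico B N, ∑ m ∈ Finset.Ico B N,
          y n * (if n = 0 then P 0 m else if m = 0 then P n 0 else (P n m + P n (-(m : ℤ))) / 2) * y m)
        + ∑ n ∈ Finset.Ico B N, ∑ m ∈ Finset.Ico B N,
          y n * ((archCoeff b n m + archCoeff b n (-(m : ℤ))) / 2) * y m := by
    rw [← Finset.sum_add_distrib, ← Finset.sum_add_distrib]
    refine Finset.sum_congr rfl fun n hn ↦ ?_
    rw [← Finset.sum_add_distrib, ← Finset.sum_add_distrib]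
    exact Finset.sum_congr rfl fun m hm ↦ hsplit n hn m hm
  -- POLAR ⪰ 0
  have hpol := even_far_lower_const_of_modes (polarCoeff b) (polarCoeff_neg_neg b) hB1 (N := N) 0
    (fun x hx _ ↦ by rw [zero_mul]; exact polarCoeff_form_nonneg_of_even hb N x hx) y
  -- PRIME₂ ⪰ −A₂/2
  have hpri := even_far_lower_const_of_modes P (fun n m ↦ primeTwo_neg_neg b n m) hB1 (N := N) (-Aop)
    (fun x _ _ ↦ by
      have h := primeTwo_form_ge_real hb h2 (modes N) x
      rw [← hAop] at h
      linarith) y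
  -- ARCH ⪰ diag(e⁺) with M₁ = B − 1
  have harch := evenArch_far_ge_diag hb (M₁ := B - 1) (by omega) (N - 1) y
  rw [← Ico_eq_Ioc_pred hB1 N] at harch
  -- assemble
  rw [hform]
  have hlhs : ∑ n ∈ Finset.Ico B N,
      ((reDigammaQuarter (freq b n) - Real.log π) / 2 - b * (1 + weilArchDensity (2 * b)) / (π ^ 2 * n ^ 2)
        - 1 / (8 * n) - b * (1 + weilArchDensity (2 * b)) / π ^ 2 * Real.sqrt (8 / ((B - 1 : ℕ) : ℝ))
        - Aop / 2) * y n ^ 2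
      = 0 / 2 * ∑ n ∈ Finset.Ico B N, y n ^ 2 + (-Aop) / 2 * ∑ n ∈ Finset.Ico B N, y n ^ 2
        + ∑ n ∈ Finset.Ico B N,
          ((reDigammaQuarter (freq b n) - Real.log π) / 2 - b * (1 + weilArchDensity (2 * b)) / (π ^ 2 * n ^ 2)
            - 1 / (8 * n) - b * (1 + weilArchDensity (2 * b)) / π ^ 2 * Real.sqrt (8 / ((B - 1 : ℕ) : ℝ)))
            * y n ^ 2 := by
    rw [zero_div, zero_mul, zero_add, Finset.mul_sum, ← Finset.sum_add_distrib]
    refine Finset.sum_congr rfl fun n _ ↦ by ring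
  rw [hlhs]
  exact add_le_add (add_le_add hpol hpri) harch

/-- **L-C3a at `S = {2}`, odd sector, arctan Hilbert weights.**  For `0 < b`, `log 2 < 2b`, `1 ≤ B` and every `N`, `z`
(kernel index `k` = mode `k+1`): `Σ_{k∈Ico B N} d̂⁻₂(k) z_k² ≤ Σ_{k,l∈Ico B N} z_k M⁻_{gram b}(k,l) z_l`
(module docstring for `d̂⁻₂`). -/
theorem gram_odd_far_ge_diag_atan (hb : 0 < b) (h2 : Real.log 2 < 2 * b) {B : ℕ} (hB : 1 ≤ B) (N : ℕ)
    (z : ℕ → ℝ) :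
    ∑ k ∈ Finset.Ico B N,
        ((reDigammaQuarter (freq b ((k : ℤ) + 1)) - Real.log π) / 2 - 1 / (8 * ((k : ℝ) + 1))
          - b * (1 + weilArchDensity (2 * b)) / (π ^ 2 * ((k : ℝ) + 1) ^ 2)
          - (π / 2 - Real.arctan (Real.sqrt B / Real.sqrt ((k : ℝ) + 1))) / 2
          - b * (1 + weilArchDensity (2 * b)) / π ^ 2 * Real.sqrt (8 / B)
          - lam * (2 * Real.cos (π / (⌊2 * b / Real.log 2⌋₊ + 2))) / 2
          - (Real.exp (b / 2) - Real.exp (-(b / 2))) ^ 2 * b / (π ^ 2 * B))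
          * z k ^ 2
      ≤ ∑ k ∈ Finset.Ico B N, ∑ l ∈ Finset.Ico B N,
          z k * ((gram b ((k : ℤ) + 1) ((l : ℤ) + 1) - gram b ((k : ℤ) + 1) (-((l : ℤ) + 1))) / 2) * z l := by
  set Aop := lam * (2 * Real.cos (π / (⌊2 * b / Real.log 2⌋₊ + 2))) with hAop
  set S2 := (Real.exp (b / 2) - Real.exp (-(b / 2))) ^ 2 with hS2
  set P : ℤ → ℤ → ℝ := fun n m ↦ lam * (incrCoeff b (Real.log 2) n m - if n = m then 2 else 0) with hP
  -- split the kernel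
  have hform : ∑ k ∈ Finset.Ico B N, ∑ l ∈ Finset.Ico B N,
      z k * ((gram b ((k : ℤ) + 1) ((l : ℤ) + 1) - gram b ((k : ℤ) + 1) (-((l : ℤ) + 1))) / 2) * z l
      = (∑ k ∈ Finset.Ico B N, ∑ l ∈ Finset.Ico B N,
          z k * ((polarCoeff b ((k : ℤ) + 1) ((l : ℤ) + 1) - polarCoeff b ((k : ℤ) + 1) (-((l : ℤ) + 1))) / 2) * z l)
        + (∑ k ∈ Finset.Ico B N, ∑ l ∈ Finset.Ico B N,
          z k * ((P ((k : ℤ) + 1) ((l : ℤ) + 1) - P ((k : ℤ) + 1) (-((l : ℤ) + 1))) / 2) * z l)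
        + ∑ k ∈ Finset.Ico B N, ∑ l ∈ Finset.Ico B N,
          z k * ((archCoeff b ((k : ℤ) + 1) ((l : ℤ) + 1) - archCoeff b ((k : ℤ) + 1) (-((l : ℤ) + 1))) / 2) * z l := by
    rw [← Finset.sum_add_distrib, ← Finset.sum_add_distrib]
    refine Finset.sum_congr rfl fun k _ ↦ ?_
    rw [← Finset.sum_add_distrib, ← Finset.sum_add_distrib]
    refine Finset.sum_congr rfl fun l _ ↦ ?_
    rw [gram_eq_yoshida hb, gram_eq_yoshida hb]
    ring
  -- POLAR ⪰ −s²b/(π²B)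
  have hpol := odd_far_lower_const_of_modes (polarCoeff b) (polarCoeff_neg_neg b) (B := B) (N := N)
    (-(2 * S2 * b / (π ^ 2 * B)))
    (fun x hx hs ↦ by
      have h := polarCoeff_form_ge_of_odd hb hB N x hx (fun p hp ↦ hs p (Or.inl hp))
      rw [← hS2] at h
      exact h) z
  -- PRIME₂ ⪰ −A₂/2
  have hpri := odd_far_lower_const_of_modes P (fun n m ↦ primeTwo_neg_neg b n m) (B := B) (N := N) (-Aop)
    (fun x _ _ ↦ by
      have h := primeTwo_form_ge_real hb h2 (modes N) x
      rw [← hAop] at h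
      linarith) z
  -- ARCH ⪰ diag(e⁻) with M₁ = B, modes n = k + 1
  have harch := oddArch_far_ge_diag_atan hb (M₁ := B) hB N (fun n ↦ z (n - 1))
  rw [← sum_Ico_succ_eq_sum_Ioc B N, ← sum_Ico_succ_eq_sum_Ioc B N] at harch
  simp only [Nat.add_sub_cancel] at harch
  have harch' : ∑ k ∈ Finset.Ico B N,
      ((reDigammaQuarter (freq b ((k : ℤ) + 1)) - Real.log π) / 2 - 1 / (8 * ((k : ℝ) + 1))
        - b * (1 + weilArchDensity (2 * b)) / (π ^ 2 * ((k : ℝ) + 1) ^ 2)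
        - (π / 2 - Real.arctan (Real.sqrt B / Real.sqrt ((k : ℝ) + 1))) / 2
        - b * (1 + weilArchDensity (2 * b)) / π ^ 2 * Real.sqrt (8 / B)) * z k ^ 2
      ≤ ∑ k ∈ Finset.Ico B N, ∑ l ∈ Finset.Ico B N,
          z k * ((archCoeff b ((k : ℤ) + 1) ((l : ℤ) + 1) - archCoeff b ((k : ℤ) + 1) (-((l : ℤ) + 1))) / 2) * z l := by
    refine le_of_eq_of_le ?_ (harch.trans (le_of_eq ?_))
    · refine Finset.sum_congr rfl fun k _ ↦ ?_
      push_cast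
      ring
    · refine Finset.sum_congr rfl fun k _ ↦ ?_
      rw [← sum_Ico_succ_eq_sum_Ioc B N]
      refine Finset.sum_congr rfl fun l _ ↦ ?_
      simp only [Nat.add_sub_cancel]
      push_cast
      ring
  -- assemble
  rw [hform]
  have hlhs : ∑ k ∈ Finset.Ico B N,
      ((reDigammaQuarter (freq b ((k : ℤ) + 1)) - Real.log π) / 2 - 1 / (8 * ((k : ℝ) + 1))
        - b * (1 + weilArchDensity (2 * b)) / (π ^ 2 * ((k : ℝ) + 1) ^ 2)
        - (π / 2 - Real.arctan (Real.sqrt B / Real.sqrt ((k : ℝ) + 1))) / 2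
        - b * (1 + weilArchDensity (2 * b)) / π ^ 2 * Real.sqrt (8 / B)
        - Aop / 2 - S2 * b / (π ^ 2 * B)) * z k ^ 2
      = (-(2 * S2 * b / (π ^ 2 * B))) / 2 * ∑ k ∈ Finset.Ico B N, z k ^ 2
        + (-Aop) / 2 * ∑ k ∈ Finset.Ico B N, z k ^ 2
        + ∑ k ∈ Finset.Ico B N,
          ((reDigammaQuarter (freq b ((k : ℤ) + 1)) - Real.log π) / 2 - 1 / (8 * ((k : ℝ) + 1))
            - b * (1 + weilArchDensity (2 * b)) / (π ^ 2 * ((k : ℝ) + 1) ^ 2)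
            - (π / 2 - Real.arctan (Real.sqrt B / Real.sqrt ((k : ℝ) + 1))) / 2
            - b * (1 + weilArchDensity (2 * b)) / π ^ 2 * Real.sqrt (8 / B)) * z k ^ 2 := by
    rw [Finset.mul_sum, Finset.mul_sum, ← Finset.sum_add_distrib, ← Finset.sum_add_distrib]
    refine Finset.sum_congr rfl fun k _ ↦ by ring
  rw [hlhs]
  exact add_le_add (add_le_add hpol hpri) harch'

end Far

end Summit.RiemannHypothesis.RiemannHypothesis.Theorems.S2FormatC

end
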